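import Summits.KontsevichZagierPeriods.KontsevichZagierPeriods.Theorems.SoloBlindTriplThird
import Summits.KontsevichZagierPeriods.KontsevichZagierPeriods.Theorems.SoloBlindLevelNine
import HarnessLib

/-!
# Level 9 in full: fourteen `S₃`-orbits, eight Deligne–Koblitz–Ogus classes, nine generators

At level `9` the exponent pairs `(k, l)` (`1 ≤ k, l ≤ 8`, `k + l ≠ 9`) form fourteen `S₃`-orbits,
seven of each kind, and EIGHT Deligne–Koblitz–Ogus classes:

* first kind: `{3,3,3}`, `{1,1,7} ∪ {1,3,5}`, `{1,2,6} ∪ {2,2,5}`, `{2,3,4} ∪ {1,4,4}`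
  (`SoloBlindTriplication`, `SoloBlindLevelNine`);
* second kind: `{6,6,6}`, `{2,8,8} ∪ {4,6,8}` (`betaQ_tripl_nine_468`),
  `{5,5,8} ∪ {5,6,7}` (`betaQ_tripl_nine_567`), `{4,7,7} ∪ {3,7,8}` (`betaQ_tripl_nine_378`).

All six merges are ONE-DIMENSIONAL chains inside the three Kontsevich–Zagier rules (the second-kind
ones need one Newton–Leibniz move each; this corrects the remark at the end of the header of
`SoloBlindLevelNine`).  Consequently

* `levelSpan_nine_eq`: `V₉ = ⟨x_π, β(1/9,1/9), β(2/9,2/9), β(1/9,4/9), β(⅓,⅓), β(8/9,8/9),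
   β(5/9,5/9), β(7/9,7/9), β(⅔,⅔)⟩_{K₀}`;
* `kz_levelNine`: if these nine periods are linearly independent over `K₀ = ℚ̄ ∩ ℝ` (one value per
  Deligne–Koblitz–Ogus class and `π`; this is what the Wolfart–Wüstholz theorem on Beta values leads
  one to expect, and it is taken here as the explicit hypothesis `h`, not proved), the period map is
  injective on the whole level-9 linear sector `V₉`.

References: J. Wolfart, G. Wüstholz, Math. Ann. 273 (1985) 1–15 (doi:10.1007/bf01455911);
P. Deligne (appendix N. Koblitz, A. Ogus), PSPM 33.2 (1979) 313–346.
-/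

namespace Summit.KontsevichZagierPeriods.KontsevichZagierPeriods.Theorems

open Literature.NumberTheory.Transcendental Literature.NumberTheory.Transcendental.KZ
open Set

noncomputable section

namespace SoloBlind

/-- Orbit representatives at level 9 (seven first-kind, seven second-kind orbits). -/
def reps9full : Finset (ℕ × ℕ) :=
  {(1, 1), (1, 2), (1, 3), (1, 4), (2, 2), (2, 3), (3, 3),
    (8, 8), (7, 8), (6, 8), (7, 7), (5, 8), (6, 7), (6, 6)}

/-- `reps9full` meets all fourteen `S₃`-orbits at level 9. -/
theorem represents9 : Represents 9 reps9full := by decide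

/-- The nine level-9 generators: `x_π` and one Beta class per Deligne–Koblitz–Ogus class. -/
def nineGensFull : Fin 9 → Q :=
  ![xPi, betaQ (1 / 9) (1 / 9), betaQ (2 / 9) (2 / 9), betaQ (1 / 9) (4 / 9), betaQ (1 / 3) (1 / 3),
    betaQ (8 / 9) (8 / 9), betaQ (5 / 9) (5 / 9), betaQ (7 / 9) (7 / 9), betaQ (2 / 3) (2 / 3)]

/-- The span of the nine generators. -/
def nineSpanFull : Submodule K₀ Q := Submodule.span K₀ (range nineGensFull)

/-- The first-kind span is contained in the full one. -/
theorem nineSpan_le_full : nineSpan ≤ nineSpanFull := by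
  refine Submodule.span_le.mpr ?_
  rintro x ⟨i, rfl⟩
  fin_cases i
  · exact Submodule.subset_span ⟨0, rfl⟩
  · exact Submodule.subset_span ⟨1, rfl⟩
  · exact Submodule.subset_span ⟨2, rfl⟩
  · exact Submodule.subset_span ⟨3, rfl⟩
  · exact Submodule.subset_span ⟨4, rfl⟩

/-- `β(8/9,8/9) ∈ ⟨nineGensFull⟩`. -/
theorem f88_mem : betaQ (8 / 9) (8 / 9) ∈ nineSpanFull := Submodule.subset_span ⟨5, rfl⟩

/-- `β(5/9,5/9) ∈ ⟨nineGensFull⟩`. -/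
theorem f55_mem : betaQ (5 / 9) (5 / 9) ∈ nineSpanFull := Submodule.subset_span ⟨6, rfl⟩

/-- `β(7/9,7/9) ∈ ⟨nineGensFull⟩`. -/
theorem f77_mem : betaQ (7 / 9) (7 / 9) ∈ nineSpanFull := Submodule.subset_span ⟨7, rfl⟩

/-- `β(2/3,2/3) ∈ ⟨nineGensFull⟩`. -/
theorem f66_mem : betaQ (2 / 3) (2 / 3) ∈ nineSpanFull := Submodule.subset_span ⟨8, rfl⟩

/-- `β(8/9,2/9) ∈ ⟨nineGensFull⟩` (orbit `{2,8,8}`). -/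
theorem f82_mem : betaQ (8 / 9) (2 / 9) ∈ nineSpanFull := by
  have h := propTo_of_sameOrbit (N := 9) (p := (8, 8)) (q := (8, 2)) (by decide) (by decide)
    (by decide)
  norm_num at h
  exact h.mem f88_mem

/-- `β(4/9,2/3) ∈ ⟨nineGensFull⟩` — the SECOND-KIND TRIPLICATION merge `{4,6,8} ~ {2,8,8}`. -/
theorem f46_mem : betaQ (4 / 9) (2 / 3) ∈ nineSpanFull := by
  have h : ((1 / 9 : ℚ) : K₀) • betaQ (4 / 9) (2 / 3) ∈ nineSpanFull := by
    rw [betaQ_tripl_nine_468]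
    exact nineSpanFull.smul_mem _ (nineSpanFull.add_mem (nineSpanFull.smul_mem _ f82_mem)
      (nineSpanFull.smul_mem _ f88_mem))
  exact (Submodule.smul_mem_iff _ (by norm_num)).mp h

/-- `β(2/3,8/9) ∈ ⟨nineGensFull⟩` (orbit `{4,6,8}`). -/
theorem f68_mem : betaQ (2 / 3) (8 / 9) ∈ nineSpanFull := by
  have h := propTo_of_sameOrbit (N := 9) (p := (4, 6)) (q := (6, 8)) (by decide) (by decide)
    (by decide)
  norm_num at h
  exact h.mem f46_mem

/-- `β(7/9,4/9) ∈ ⟨nineGensFull⟩` (orbit `{4,7,7}`). -/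
theorem f74_mem : betaQ (7 / 9) (4 / 9) ∈ nineSpanFull := by
  have h := propTo_of_sameOrbit (N := 9) (p := (7, 7)) (q := (7, 4)) (by decide) (by decide)
    (by decide)
  norm_num at h
  exact h.mem f77_mem

/-- `β(8/9,1/3) ∈ ⟨nineGensFull⟩` — the SECOND-KIND TRIPLICATION merge `{3,7,8} ~ {4,7,7}`. -/
theorem f83_mem : betaQ (8 / 9) (1 / 3) ∈ nineSpanFull := by
  have h : ((2 / 9 : ℚ) : K₀) • betaQ (8 / 9) (1 / 3) ∈ nineSpanFull := by
    rw [betaQ_tripl_nine_378]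
    exact nineSpanFull.smul_mem _ (nineSpanFull.add_mem (nineSpanFull.smul_mem _ f74_mem)
      (nineSpanFull.smul_mem _ f77_mem))
  exact (Submodule.smul_mem_iff _ (by norm_num)).mp h

/-- `β(7/9,8/9) ∈ ⟨nineGensFull⟩` (orbit `{3,7,8}`). -/
theorem f78_mem : betaQ (7 / 9) (8 / 9) ∈ nineSpanFull := by
  have h := propTo_of_sameOrbit (N := 9) (p := (8, 3)) (q := (7, 8)) (by decide) (by decide)
    (by decide)
  norm_num at h
  exact h.mem f83_mem

/-- `β(5/9,8/9) ∈ ⟨nineGensFull⟩` (orbit `{5,5,8}`). -/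
theorem f58_mem : betaQ (5 / 9) (8 / 9) ∈ nineSpanFull := by
  have h := propTo_of_sameOrbit (N := 9) (p := (5, 5)) (q := (5, 8)) (by decide) (by decide)
    (by decide)
  norm_num at h
  exact h.mem f55_mem

/-- `β(7/9,2/3) ∈ ⟨nineGensFull⟩` — the SECOND-KIND TRIPLICATION merge `{5,6,7} ~ {5,5,8}`. -/
theorem f76_mem : betaQ (7 / 9) (2 / 3) ∈ nineSpanFull := by
  have h : ((4 / 9 : ℚ) : K₀) • betaQ (7 / 9) (2 / 3) ∈ nineSpanFull := by
    rw [betaQ_tripl_nine_567]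
    exact nineSpanFull.smul_mem _ (nineSpanFull.add_mem (nineSpanFull.smul_mem _ f55_mem)
      (nineSpanFull.smul_mem _ f58_mem))
  exact (Submodule.smul_mem_iff _ (by norm_num)).mp h

/-- `β(2/3,7/9) ∈ ⟨nineGensFull⟩` (orbit `{5,6,7}`). -/
theorem f67_mem : betaQ (2 / 3) (7 / 9) ∈ nineSpanFull := by
  have h := propTo_of_sameOrbit (N := 9) (p := (7, 6)) (q := (6, 7)) (by decide) (by decide)
    (by decide)
  norm_num at h
  exact h.mem f76_mem

/-- Every generator of the orbit description of `V₉` lies in `⟨nineGensFull⟩`. -/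
theorem levelGens_nine_mem (i : Option ↥reps9full) : levelGens 9 reps9full i ∈ nineSpanFull := by
  rcases i with _ | ⟨⟨k, l⟩, hr⟩
  · exact Submodule.subset_span ⟨0, rfl⟩
  · simp only [reps9full, Finset.mem_insert, Finset.mem_singleton, Prod.mk.injEq] at hr
    simp only [levelGens]
    rcases hr with ⟨rfl, rfl⟩ | ⟨rfl, rfl⟩ | ⟨rfl, rfl⟩ | ⟨rfl, rfl⟩ | ⟨rfl, rfl⟩ | ⟨rfl, rfl⟩ |
      ⟨rfl, rfl⟩ | ⟨rfl, rfl⟩ | ⟨rfl, rfl⟩ | ⟨rfl, rfl⟩ | ⟨rfl, rfl⟩ | ⟨rfl, rfl⟩ | ⟨rfl, rfl⟩ |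
      ⟨rfl, rfl⟩
    · norm_num; exact nineSpan_le_full n11_mem
    · norm_num; exact nineSpan_le_full n12_mem
    · norm_num; exact nineSpan_le_full n13_mem
    · norm_num; exact nineSpan_le_full n14_mem
    · norm_num; exact nineSpan_le_full n22_mem
    · norm_num; exact nineSpan_le_full n23_mem
    · norm_num; exact nineSpan_le_full n33_mem
    · norm_num; exact f88_mem
    · norm_num; exact f78_mem
    · norm_num; exact f68_mem
    · norm_num; exact f77_mem
    · norm_num; exact f58_mem
    · norm_num; exact f67_mem
    · norm_num; exact f66_mem

/-- **`V₉ ⊆ ⟨nineGensFull⟩`.** -/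
theorem levelSpan_nine_le : levelSpan 9 ≤ nineSpanFull := by
  rw [levelSpan_eq (by norm_num) represents9]
  exact Submodule.span_le.mpr (by rintro x ⟨i, rfl⟩; exact levelGens_nine_mem i)

/-- The nine generators lie in `V₉`, so `V₉` IS their span. -/
theorem levelSpan_nine_eq : levelSpan 9 = nineSpanFull := by
  refine le_antisymm levelSpan_nine_le (Submodule.span_le.mpr ?_)
  rintro x ⟨i, rfl⟩
  fin_cases i
  · exact Submodule.subset_span (mem_insert _ _)
  · exact Submodule.subset_span (mem_insert_of_mem _ ⟨1, 1, 0, 0, le_rfl, by norm_num, le_rfl,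
      by norm_num, by norm_num [nineGensFull]⟩)
  · exact Submodule.subset_span (mem_insert_of_mem _ ⟨2, 2, 0, 0, by norm_num, by norm_num,
      by norm_num, by norm_num, by norm_num [nineGensFull]⟩)
  · exact Submodule.subset_span (mem_insert_of_mem _ ⟨1, 4, 0, 0, le_rfl, by norm_num,
      by norm_num, by norm_num, by norm_num [nineGensFull]⟩)
  · exact Submodule.subset_span (mem_insert_of_mem _ ⟨3, 3, 0, 0, by norm_num, by norm_num,
      by norm_num, by norm_num, by norm_num [nineGensFull]⟩)
  · exact Submodule.subset_span (mem_insert_of_mem _ ⟨8, 8, 0, 0, by norm_num, by norm_num,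
      by norm_num, by norm_num, by norm_num [nineGensFull]⟩)
  · exact Submodule.subset_span (mem_insert_of_mem _ ⟨5, 5, 0, 0, by norm_num, by norm_num,
      by norm_num, by norm_num, by norm_num [nineGensFull]⟩)
  · exact Submodule.subset_span (mem_insert_of_mem _ ⟨7, 7, 0, 0, by norm_num, by norm_num,
      by norm_num, by norm_num, by norm_num [nineGensFull]⟩)
  · exact Submodule.subset_span (mem_insert_of_mem _ ⟨6, 6, 0, 0, by norm_num, by norm_num,
      by norm_num, by norm_num, by norm_num [nineGensFull]⟩)

/-- The periods of the nine generators, as Gamma quotients `B(a,b) = Γ(a)Γ(b)/Γ(a+b)`. -/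
theorem evalQ_nineGensFull : (fun i => evalQ (nineGensFull i)) =
    ![Real.pi, Real.Gamma (1 / 9) * Real.Gamma (1 / 9) / Real.Gamma (2 / 9),
      Real.Gamma (2 / 9) * Real.Gamma (2 / 9) / Real.Gamma (4 / 9),
      Real.Gamma (1 / 9) * Real.Gamma (4 / 9) / Real.Gamma (5 / 9),
      Real.Gamma (1 / 3) * Real.Gamma (1 / 3) / Real.Gamma (2 / 3),
      Real.Gamma (8 / 9) * Real.Gamma (8 / 9) / Real.Gamma (16 / 9),
      Real.Gamma (5 / 9) * Real.Gamma (5 / 9) / Real.Gamma (10 / 9),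
      Real.Gamma (7 / 9) * Real.Gamma (7 / 9) / Real.Gamma (14 / 9),
      Real.Gamma (2 / 3) * Real.Gamma (2 / 3) / Real.Gamma (4 / 3)] := by
  funext i
  fin_cases i
  · exact evalQ_xPi
  · show evalQ (betaQ (1 / 9) (1 / 9)) = _
    rw [evalQ_betaQ (by norm_num) (by norm_num)]; norm_num
  · show evalQ (betaQ (2 / 9) (2 / 9)) = _
    rw [evalQ_betaQ (by norm_num) (by norm_num)]; norm_num
  · show evalQ (betaQ (1 / 9) (4 / 9)) = _
    rw [evalQ_betaQ (by norm_num) (by norm_num)]; norm_num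
  · show evalQ (betaQ (1 / 3) (1 / 3)) = _
    rw [evalQ_betaQ (by norm_num) (by norm_num)]; norm_num
  · show evalQ (betaQ (8 / 9) (8 / 9)) = _
    rw [evalQ_betaQ (by norm_num) (by norm_num)]; norm_num
  · show evalQ (betaQ (5 / 9) (5 / 9)) = _
    rw [evalQ_betaQ (by norm_num) (by norm_num)]; norm_num
  · show evalQ (betaQ (7 / 9) (7 / 9)) = _
    rw [evalQ_betaQ (by norm_num) (by norm_num)]; norm_num
  · show evalQ (betaQ (2 / 3) (2 / 3)) = _
    rw [evalQ_betaQ (by norm_num) (by norm_num)]; norm_num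

/-- **Level 9.** If `π, B(1/9,1/9), B(2/9,2/9), B(1/9,4/9), B(⅓,⅓), B(8/9,8/9), B(5/9,5/9),
B(7/9,7/9), B(⅔,⅔)` — `π` and one value per Deligne–Koblitz–Ogus class — are linearly independent
over `K₀ = ℚ̄ ∩ ℝ` (hypothesis `h`; expected from Wolfart–Wüstholz, not proved here), then the period
map is injective on `V₉`: every `K₀`-linear
relation among level-9 Beta words and `π` with vanishing period is a consequence of the three
Kontsevich–Zagier rules (the proof uses six triplication chains, three of them with a
Newton–Leibniz move). -/
theorem kz_levelNine (h : LinearIndependent K₀ fun i => evalQ (nineGensFull i)) {z : Q}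
    (hz : z ∈ levelSpan 9) (h0 : evalQ z = 0) : z = 0 := by
  obtain ⟨c, rfl⟩ := (Submodule.mem_span_range_iff_exists_fun K₀).mp (levelSpan_nine_le hz)
  have hsum : ∑ i, c i • evalQ (nineGensFull i) = 0 := by
    rw [map_sum] at h0
    simpa only [evalQ_smul, IntermediateField.smul_def, smul_eq_mul] using h0
  have hc : ∀ i, c i = 0 := Fintype.linearIndependent_iff.mp h c hsum
  simp [hc]

/-- The period map is injective on `V₉` (same hypothesis). -/
theorem evalQ_injOn_levelSpan_nine (h : LinearIndependent K₀ fun i => evalQ (nineGensFull i)) :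
    InjOn evalQ (levelSpan 9) := fun x hx y hy hxy => sub_eq_zero.mp
  (kz_levelNine h ((levelSpan 9).sub_mem hx hy) (by rw [map_sub, hxy, sub_self]))

end SoloBlind

end

end Summit.KontsevichZagierPeriods.KontsevichZagierPeriods.Theorems
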